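import Summits.Ventures.YMGap.Census.TwistSheet
import Summits.Ventures.YMGap.Census.TwistFieldLine
import Summits.Ventures.YMGap.Census.HypercubeExponentQuarter
import Summits.Ventures.YMGap.Census.CoeffMonotone
import HarnessLib

/-!
# Venture YMGap, track (b) — Tomboulis's Prop. IV.2 (i) `∂Z⁺/∂c_j ≥ 0` for EVERY spin cut-off on every even torus,
# and the left half `Z⁻_Λ > 0` of (5.3) (weak form, `d ≥ 3`)

HONEST FRAMING: venture file of the cell `pub-ymgap` (QuantumFields programme), track (b); finite tori `(ℤ/Lℤ)^d`, `L` even;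
nothing about Tomboulis's (5.15), limits, confinement or a mass gap.

Tomboulis, arXiv:0707.2179, Prop. IV.2 (i) (eq. (4.9)): for `c_j ≥ 0`, `Z⁺_Λ = (Z_Λ + Z⁻_Λ)/2` "is an increasing function of
each `c_j`", `∂Z⁺_Λ({c_i})/∂c_j ≥ 0`; App. A §2 (p. 21): "`Z⁺ = ∫ dμ⁰ P⁺_𝒱 P⁺_{𝒱'}` … the measure in `Z⁺` possesses RP in all
planes. IV.2 (i) is a trivial consequence of this fact."  Kernel form of that consequence (the marked-plaquette argument of
`CoeffMonotone` for the pair `Z + Z⁻`): `∂/∂c_k (Z + Z⁻) = Σ_{p₀}` (marked `Z` + marked `Z⁻`) (`TwistFieldLine`); each marked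
plaquette is transported onto the reflection hyperplane (`CubePattern.exists_isCrossPlaq_transport`), the transported twist set
is a translated sheet (`TwistSheet.exists_sheetAt_transport`), and `TwistSheet.coefFieldZ_add_twist_sheetAt_nonneg` gives the
sign of the PAIR.  The same reflection-positivity case analysis gives the left inequality of (5.3),
`1 < 1 + Z⁻_Λ/Z_Λ` — printed "by IV.1" although IV.1 (eq. (4.5): `Z⁻ ≤ Z`) is only its right half — in the weak form
`0 ≤ Z⁻_Λ` on every even torus of dimension `d ≥ 3` (sheet parallel to the reflection hyperplanes).

## Main statements (namespace `Summit.Ventures.YMGap.Census`)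

* `torusZtw_vortexSheet_nonneg` — `3 ≤ d`, `L` even, every `J`, every plane, `c_j ≥ 0`: `0 ≤ Z⁻_Λ({c_j})`.
* `torusZplus_update_mono`, **`torusZplus_mono`** — `L` even, every `d ≥ 2`, `J`, plane: `c ≤ c'` admissible ⟹
  `Z⁺_Λ({c_j}) ≤ Z⁺_Λ({c'_j})` (Prop. IV.2 (i)).

References: E. T. Tomboulis, arXiv:0707.2179, Prop. IV.2 (i) eq. (4.9), App. A §2, §5 eq. (5.3)
[cite: Tomboulis2007Confinement, Prop. IV.2, App. A §2, eq. (5.3)]; K. Osterwalder, E. Seiler, Ann. Phys. 110 (1978) 440, §2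
[cite: OsterwalderSeilerAnnPhys1978, §2].
-/

noncomputable section

open MeasureTheory Finset Real
open scoped BigOperators
open Literature.MathematicalPhysics.QuantumLattice
open Literature.MathematicalPhysics.QuantumFieldTheory
open Literature.MathematicalPhysics.QuantumFieldTheory.Tomboulis2007
open Literature.MathematicalPhysics.QuantumFieldTheory.WilsonRP

namespace Summit.Ventures.YMGap.Census

variable {d L : ℕ}

/-! ### (5.3), left half: `0 ≤ Z⁻_Λ` on even tori of dimension `d ≥ 3` -/

/-- **The twisted partition function is non-negative** (the left inequality `1 < 1 + Z⁻_Λ/Z_Λ` of arXiv:0707.2179 eq. (5.3),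
weak form): on the even torus `(ℤ/Lℤ)^d`, `d ≥ 3`, for every spin cut-off `J`, every plane `(i, j)` and all `c_j ≥ 0`,
`0 ≤ Z⁻_Λ({c_j})`.  Proof: by plane symmetry the sheet may be taken in the plane `(1, 2)`, which does not contain the time axis;
that sheet is invariant under the reflection and contains no crossing plaquette, so the twisted weight is itself reflection
positive (`coefFieldZ_twist_nonneg_of_reflect`). -/
theorem torusZtw_vortexSheet_nonneg (hd : 3 ≤ d) [NeZero L] (hL : Even L) (J : ℕ) {i j : Fin d} (hij : i < j)
    {c : ℕ → ℝ} (hc : ∀ n, 1 ≤ n → 0 ≤ c n) : 0 ≤ torusZtw d L J c (vortexSheet L i j hij) := by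
  haveI : NeZero d := ⟨by omega⟩
  have hL1 : 1 < L := by
    have h0 : L ≠ 0 := NeZero.ne L
    obtain ⟨m, hm⟩ := hL
    omega
  haveI : Fact (1 < L) := ⟨hL1⟩
  have h01 : (0 : Fin d) < 1 := by
    rw [Fin.lt_def, Fin.val_zero, Fin.val_one']
    rw [Nat.one_mod_eq_one.mpr (by omega)]
    exact Nat.one_pos
  have h12 : (⟨1, by omega⟩ : Fin d) < ⟨2, by omega⟩ := Fin.mk_lt_mk.2 (by norm_num)
  rw [torusZtw_vortexSheet_eq_plane_zero_one h01 hij, ← torusZtw_vortexSheet_eq_plane_zero_one h01 h12,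
    torusZtw_eq_coefFieldZ_twistField, vortexSheet_eq_sheetAt]
  have h1 : (⟨1, by omega⟩ : Fin d) ≠ 0 := fun h => by
    have := congrArg Fin.val h
    simp at this
  exact coefFieldZ_twist_nonneg_of_reflect hL J (fun p hp => not_isCrossPlaq_of_mem_sheetAt h12 h1 hp)
    (fun p _ => plaqReflect_mem_sheetAt_iff h12 h1 0 0 p) (fun _ _ => rfl) (fun _ _ n => stdCoef_nonneg hc n)

/-- Hence the vortex free-energy ratio `Z⁻_Λ/Z_Λ = exp(-F⁻_Λ)` is non-negative (`d ≥ 3`, `L` even, admissible `c`;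
`Z_Λ ≥ 1` by `HypercubeExponentQuarter.one_le_torusZ_even`). -/
theorem vortexRatio_vortexSheet_nonneg (hd : 3 ≤ d) [NeZero L] (hL : Even L) (J : ℕ) {i j : Fin d} (hij : i < j)
    {c : ℕ → ℝ} (hc : CoeffAdmissible c) : 0 ≤ vortexRatio d L J c (vortexSheet L i j hij) := by
  unfold vortexRatio
  exact div_nonneg (torusZtw_vortexSheet_nonneg hd hL J hij fun n hn => (hc n hn).1)
    (zero_le_one.trans (one_le_torusZ_even hd hL J hc))

/-! ### The marked pair `Z(G) + Z(G⁻)` for a uniform field marked at one plaquette -/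

section Marked

variable [NeZero d] [NeZero L] [Fact (1 < L)]

omit [NeZero d] [Fact (1 < L)] in
/-- Pulling a twisted field back along a map of plaquettes twists the pulled-back field on the preimage of the twist set. -/
theorem twistField_comp (V : Finset (Plaquette d L)) (F : Plaquette d L → ℕ → ℝ) (g : Plaquette d L → Plaquette d L) :
    (fun q => twistField V F (g q)) = twistField (univ.filter fun q => g q ∈ V) (fun q => F (g q)) := by
  funext q
  by_cases h : g q ∈ V
  · rw [twistField_of_mem h, twistField_of_mem (by simp [h])]
  · rw [twistField_of_not_mem h, twistField_of_not_mem (by simp [h])]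

omit [NeZero L] [Fact (1 < L)] in
/-- Pulling back a uniform field marked at `p₀` along the inverse transport gives the uniform field marked at the transported
plaquette. -/
theorem update_const_comp_transport (u w : ℕ → ℝ) (p₀ : Plaquette d L) (μ : Fin d) (v : Site d L) :
    (fun q => Function.update (fun _ : Plaquette d L => u) p₀ w (plaqTranspose 0 μ (plaqShift (-v) q))) =
      Function.update (fun _ : Plaquette d L => u) (plaqShift v (plaqTranspose 0 μ p₀)) w := by
  funext q
  by_cases hq : q = plaqShift v (plaqTranspose 0 μ p₀)
  · subst hq
    rw [Function.update_self, plaqShift_neg_plaqShift, plaqTranspose_plaqTranspose', Function.update_self]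
  · have hne : plaqTranspose 0 μ (plaqShift (-v) q) ≠ p₀ := fun h =>
      hq (by rw [← h, plaqTranspose_plaqTranspose', plaqShift_plaqShift_neg])
    rw [Function.update_of_ne hne, Function.update_of_ne hq]

/-- A uniform field marked at a CROSSING plaquette is mirror-symmetric off the crossing plaquettes. -/
theorem update_const_reflect {u w : ℕ → ℝ} {r : Plaquette d L} (hL : Even L) (hr : IsCrossPlaq r) (p : Plaquette d L)
    (hp : ¬ IsCrossPlaq p) :
    Function.update (fun _ : Plaquette d L => u) r w (plaqReflect p) = Function.update (fun _ : Plaquette d L => u) r w p := by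
  have h1 : p ≠ r := fun h => hp (h ▸ hr)
  have h2 : plaqReflect p ≠ r := fun h => not_isCrossPlaq_plaqReflect hL hp (h ▸ hr)
  rw [Function.update_of_ne h1, Function.update_of_ne h2]

/-- **The marked pair is non-negative**: for non-negative coefficient vectors `u` (everywhere) and `w` (at the marked plaquette
`p₀`) and the twist on ANY translated `(0,1)`-sheet, `0 ≤ Z(G) + Z(G⁻)` with `G = update (uniform u) p₀ w` — transport `p₀` onto
the reflection hyperplane and apply `coefFieldZ_add_twist_transport_nonneg`. -/
theorem coefFieldZ_add_twist_marked_nonneg (hL : Even L) (h01 : (0 : Fin d) < 1) (J : ℕ) {u w : ℕ → ℝ}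
    (hu : ∀ n, 0 ≤ u n) (hw : ∀ n, 0 ≤ w n) (a b : ZMod L) (p₀ : Plaquette d L) :
    0 ≤ coefFieldZ J (Function.update (fun _ : Plaquette d L => u) p₀ w) +
      coefFieldZ J (twistField (sheetAt 0 1 h01 a b) (Function.update (fun _ : Plaquette d L => u) p₀ w)) := by
  obtain ⟨μ, v, hcross⟩ := exists_isCrossPlaq_transport (d := d) (L := L) p₀
  rw [coefFieldZ_transport J (Function.update (fun _ : Plaquette d L => u) p₀ w) μ v,
    coefFieldZ_transport J (twistField (sheetAt 0 1 h01 a b) (Function.update (fun _ : Plaquette d L => u) p₀ w)) μ v,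
    twistField_comp, update_const_comp_transport]
  have hupos : ∀ q n, 0 ≤ Function.update (fun _ : Plaquette d L => u) (plaqShift v (plaqTranspose 0 μ p₀)) w q n := by
    intro q n
    by_cases hq : q = plaqShift v (plaqTranspose 0 μ p₀)
    · subst hq; rw [Function.update_self]; exact hw n
    · rw [Function.update_of_ne hq]; exact hu n
  exact coefFieldZ_add_twist_transport_nonneg hL J (fun p hp => update_const_reflect hL hcross p hp)
    (fun q _ n => hupos q n) h01 μ v a b

end Marked

/-! ### Prop. IV.2 (i): one coordinate at a time -/

section Mono

variable [NeZero d] [NeZero L] [Fact (1 < L)]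

omit [NeZero d] [NeZero L] [Fact (1 < L)] in
/-- `stdCoef (update c k (c k + τ)) = stdCoef c + τ · singleCoef k` for `k ≥ 1`. -/
theorem stdCoef_update (c : ℕ → ℝ) {k : ℕ} (hk1 : 1 ≤ k) (τ : ℝ) :
    stdCoef (Function.update c k (c k + τ)) = fun n => stdCoef c n + τ * singleCoef k n := by
  funext n
  unfold stdCoef singleCoef
  by_cases hn0 : n = 0
  · subst hn0
    have hk0 : (0 : ℕ) ≠ k := by omega
    simp [hk0]
  · by_cases hnk : n = k
    · subst hnk
      simp only [hn0, if_false, Function.update_self, if_true]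
      ring
    · simp only [hn0, if_false, Function.update_of_ne hnk, hnk]
      ring

omit [NeZero d] [NeZero L] [Fact (1 < L)] in
/-- Twisting is additive: `(A + B)⁻ = A⁻ + B⁻`. -/
theorem twistField_add' (V : Finset (Plaquette d L)) (A B : Plaquette d L → ℕ → ℝ) :
    twistField V (fun p n => A p n + B p n) = fun p n => twistField V A p n + twistField V B p n := by
  funext p n
  by_cases hp : p ∈ V
  · simp only [twistField, hp, if_true, twistVec]; ring
  · simp only [twistField, hp, if_false]

omit [NeZero d] [NeZero L] [Fact (1 < L)] in
/-- Twisting is linear along the line: `(A + tB)⁻ = A⁻ + t B⁻`. -/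
theorem twistField_line (V : Finset (Plaquette d L)) (A B : Plaquette d L → ℕ → ℝ) (t : ℝ) :
    twistField V (fun p n => A p n + t * B p n) = fun p n => twistField V A p n + t * twistField V B p n := by
  funext p n
  by_cases hp : p ∈ V
  · simp only [twistField, hp, if_true, twistVec]; ring
  · simp only [twistField, hp, if_false]

omit [NeZero d] [Fact (1 < L)] in
/-- `Z⁻_Λ` depends only on the coefficients `c_1, …, c_J`. -/
theorem torusZtw_congr (J : ℕ) {c₁ c₂ : ℕ → ℝ} (h : ∀ n ∈ Icc 1 J, c₁ n = c₂ n) (V : Finset (Plaquette d L)) :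
    torusZtw d L J c₁ V = torusZtw d L J c₂ V := by
  unfold torusZtw
  refine integral_congr_ae (ae_of_all _ fun W => Finset.prod_congr rfl fun p _ => ?_)
  have h1 : plaqFn J c₁ (plaquetteHolonomy W p.1 p.2.1.1 p.2.1.2) = plaqFn J c₂ (plaquetteHolonomy W p.1 p.2.1.1 p.2.1.2) := by
    unfold plaqFn
    rw [Finset.sum_congr rfl fun n hn => by rw [h n hn]]
  have h2 : plaqFnTwist J c₁ (plaquetteHolonomy W p.1 p.2.1.1 p.2.1.2) =
      plaqFnTwist J c₂ (plaquetteHolonomy W p.1 p.2.1.1 p.2.1.2) := by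
    unfold plaqFnTwist
    rw [Finset.sum_congr rfl fun n hn => by rw [h n hn]]
  rw [h1, h2]

/-- **Prop. IV.2 (i), one coordinate**: on the even torus, for every spin cut-off `J`, `c_j ≥ 0`, `1 ≤ k ≤ J` and `τ ≥ 0`,
raising `c_k` to `c_k + τ` does not decrease `Z⁺_Λ = (Z_Λ + Z⁻_Λ)/2` (twist on any translated `(0,1)`-sheet). -/
theorem torusZplus_update_mono_sheetAt (hL : Even L) (h01 : (0 : Fin d) < 1) (J : ℕ) {c : ℕ → ℝ}
    (hc : ∀ n, 1 ≤ n → 0 ≤ c n) {k : ℕ} (hk1 : 1 ≤ k) {τ : ℝ} (hτ : 0 ≤ τ) (a b : ZMod L) :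
    torusZplus d L J c (sheetAt 0 1 h01 a b) ≤ torusZplus d L J (Function.update c k (c k + τ)) (sheetAt 0 1 h01 a b) := by
  rw [torusZplus_eq_coefFieldZ, torusZplus_eq_coefFieldZ]
  refine div_le_div_of_nonneg_right ?_ zero_le_two
  -- the two lines: `A + tB` (uniform) and its twist
  set V := sheetAt (L := L) 0 1 h01 a b with hV
  set A : Plaquette d L → ℕ → ℝ := fun _ => stdCoef c with hA
  set B : Plaquette d L → ℕ → ℝ := fun _ n => τ * singleCoef k n with hB
  have h1 : (fun _ : Plaquette d L => stdCoef (Function.update c k (c k + τ))) = fun p n => A p n + B p n := by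
    funext p n; rw [stdCoef_update c hk1 τ]
  rw [h1, twistField_add' V A B]
  refine coefFieldZ_add_le_of_marked_nonneg J A B (twistField V A) (twistField V B) fun t ht p₀ => ?_
  -- identify the marked fields at parameter `t`
  have hline : (fun p n => A p n + t * B p n) = fun _ : Plaquette d L => fun n => stdCoef c n + t * (τ * singleCoef k n) := by
    funext p n; rfl
  have hline' : (fun p n => twistField V A p n + t * twistField V B p n) = twistField V (fun p n => A p n + t * B p n) :=
    (twistField_line V A B t).symm
  have hB' : twistField V B p₀ = twistField V (fun _ : Plaquette d L => B p₀) p₀ := rfl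
  rw [hline', hB', ← twistField_update, hline]
  refine coefFieldZ_add_twist_marked_nonneg hL h01 J (fun n => ?_) (fun n => ?_) a b p₀
  · exact add_nonneg (stdCoef_nonneg hc n) (mul_nonneg ht.le (mul_nonneg hτ (singleCoef_nonneg k n)))
  · exact mul_nonneg hτ (singleCoef_nonneg k n)

/-- **Prop. IV.2 (i) along the coefficient order, twist in the `(0,1)` plane**: `c ≤ c'` admissible ⟹ `Z⁺(c) ≤ Z⁺(c')`. -/
theorem torusZplus_mono_zero_one (hL : Even L) (h01 : (0 : Fin d) < 1) (J : ℕ) {c c' : ℕ → ℝ} (hc : CoeffAdmissible c)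
    (hc' : CoeffAdmissible c') (hle : ∀ n, c n ≤ c' n) :
    torusZplus d L J c (vortexSheet L 0 1 h01) ≤ torusZplus d L J c' (vortexSheet L 0 1 h01) := by
  rw [vortexSheet_eq_sheetAt]
  -- hybrid vectors: `c'` below `m`, `c` from `m` on (as in `CoeffMonotone.coeffMonotone`)
  let mix : ℕ → ℕ → ℝ := fun m n => if n < m then c' n else c n
  have hmix_nonneg : ∀ m n, 1 ≤ n → 0 ≤ mix m n := fun m n hn => by
    simp only [mix]
    split_ifs
    · exact (hc' n hn).1
    · exact (hc n hn).1
  have hcongr : ∀ {c₁ c₂ : ℕ → ℝ}, (∀ n ∈ Icc 1 J, c₁ n = c₂ n) →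
      torusZplus d L J c₁ (sheetAt 0 1 h01 0 0) = torusZplus d L J c₂ (sheetAt 0 1 h01 0 0) := fun h => by
    unfold torusZplus
    rw [torusZ_congr J h, torusZtw_congr J h]
  have hstep : ∀ m, torusZplus d L J c (sheetAt 0 1 h01 0 0) ≤ torusZplus d L J (mix m) (sheetAt 0 1 h01 0 0) := by
    intro m
    induction m with
    | zero =>
      have : mix 0 = c := funext fun n => by simp [mix]
      rw [this]
    | succ m ih =>
      have hupd : mix (m + 1) = Function.update (mix m) m (mix m m + (c' m - c m)) := by
        funext n
        by_cases hnm : n = m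
        · subst hnm
          rw [Function.update_self]
          simp [mix]
        · rw [Function.update_of_ne hnm]
          simp only [mix]
          have : n < m + 1 ↔ n < m := by omega
          simp only [this]
      refine ih.trans ?_
      rw [hupd]
      by_cases hm : m ∈ Icc 1 J
      · exact torusZplus_update_mono_sheetAt hL h01 J (hmix_nonneg m) (Finset.mem_Icc.1 hm).1 (sub_nonneg.2 (hle m)) 0 0
      · exact le_of_eq (hcongr fun n hn => by rw [Function.update_of_ne (fun h => hm (by rw [← h]; exact hn))])
  refine (hstep (J + 1)).trans (le_of_eq (hcongr fun n hn => ?_))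
  have : n < J + 1 := Nat.lt_succ_of_le (Finset.mem_Icc.1 hn).2
  simp [mix, this]

end Mono

/-! ### Prop. IV.2 (i) for every plane -/

/-- **Tomboulis's Prop. IV.2 (i) (arXiv:0707.2179 eq. (4.9)) for every spin cut-off, on the even torus, every plane**:
for `L` even, `d ≥ 2`, every `J` and admissible coefficient vectors `c ≤ c'` (only `c_j ≥ 0` is used),
`Z⁺_Λ({c_j}) ≤ Z⁺_Λ({c'_j})` with `Z⁺ = (Z + Z⁻)/2` and the twist on Tomboulis's vortex sheet `𝒱_{ij}`. -/
theorem torusZplus_mono [NeZero L] (hL : Even L) (J : ℕ) {i j : Fin d} (hij : i < j) {c c' : ℕ → ℝ}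
    (hc : CoeffAdmissible c) (hc' : CoeffAdmissible c') (hle : ∀ n, c n ≤ c' n) :
    torusZplus d L J c (vortexSheet L i j hij) ≤ torusZplus d L J c' (vortexSheet L i j hij) := by
  have hd : 2 ≤ d := by
    have hj := j.isLt
    have : i.val < j.val := hij
    omega
  haveI : NeZero d := ⟨by omega⟩
  have hL1 : 1 < L := by
    have h0 : L ≠ 0 := NeZero.ne L
    obtain ⟨m, hm⟩ := hL
    omega
  haveI : Fact (1 < L) := ⟨hL1⟩
  have h01 : (0 : Fin d) < 1 := by
    rw [Fin.lt_def, Fin.val_zero, Fin.val_one']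
    rw [Nat.one_mod_eq_one.mpr (by omega)]
    exact Nat.one_pos
  unfold torusZplus
  rw [torusZtw_vortexSheet_eq_plane_zero_one h01 hij, torusZtw_vortexSheet_eq_plane_zero_one h01 hij]
  exact torusZplus_mono_zero_one hL h01 J hc hc' hle

end Summit.Ventures.YMGap.Census

end
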